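import Summits.SmoothPoincare4.SmoothPoincare4.Theorems.SullivanDualTargetHelperStarConvexHalfAxis
import Summits.SmoothPoincare4.SmoothPoincare4.Theorems.SullivanDualTargetHelperStarConvexHalfPlane
import Summits.SmoothPoincare4.SmoothPoincare4.Theorems.SullivanDualTargetHelperPreconnectedBallDiffPlane
import Summits.SmoothPoincare4.SmoothPoincare4.Theorems.SullivanDualTargetHelperMayerVietorisSucc
import Summits.SmoothPoincare4.SmoothPoincare4.Theorems.SullivanDualTargetHelperMayerVietorisOne
import Literature.Geometry.Kaehler.StarShapedLocalPoincare
import Mathlib.Geometry.Manifold.Instances.Real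

/-!
# SmoothPoincare4 / SullivanDual — crux `Target` (stmt-SmoothPoincare4-7823), line `Sketch`:
# the Poincaré lemma in degree two for a punctured chart `4`-ball

`H²_dR(B⁴ ∖ 0) = 0` in the tree's language of local forms: on a `C^∞` manifold `M` charted on
`ℝ⁴`, for a point `p` and a radius `r` with `ball (e p) r ⊆ e.target` (`e = extChartAt (𝓡 4) p`),
every smooth closed `2`-form on the punctured chart-ball
`W = chartSet (𝓡 4) p (ball (e p) r ∖ {e p})` is `d_W` of a smooth `1`-form on `W`
(`helper_poincareLemma_two_puncturedChartBall`; registered helper stub of crux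
`stmt-SmoothPoincare4-7823`, consumed by `helper_primitiveOnPuncturedBall`, on the way to
"closed taming kills witnesses").

Proof: two nested Mayer–Vietoris steps over the landed criteria
`helper_localClosedForms_succ_union_le_of_inter` (degree `k + 1` from `H^{k+1}(P) = H^{k+1}(Q) = 0`
and `H^k(P ∩ Q) = 0`) and `helper_localClosedForms_one_union_le_of_isPreconnected` (degree one
from `H¹(P) = H¹(Q) = 0` and `P ∩ Q` connected), applied to chart sets of the flat pieces
"ball minus a closed half-axis" (`helper_starConvex_ball_diff_halfAxis`, star-shaped, covering
the punctured ball, meeting in "ball minus the axis") and "ball minus a closed half-plane"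
(`helper_starConvex_ball_diff_halfPlane`, star-shaped, covering "ball minus the axis", meeting in
"ball minus a plane", which is connected: `helper_isPreconnected_ball_diff_plane`); star-shaped
chart sets are acyclic by the Poincaré lemma (cone operator, Lee (2013), Thm. 17.14 — the tree's
`Literature.Geometry.Kaehler.localClosedForms_chartSet_le_localExactForms_of_starConvex`, which pins
the manifold to the universe of its model space; hence `M : Type` in the main theorem).

References: R. Bott, L. W. Tu, *Differential Forms in Algebraic Topology* (1982), Prop. 2.3,
§I.4 [BottTu1982Forms]; J. M. Lee, *Introduction to Smooth Manifolds*, 2nd ed. (2013),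
Thm. 17.14, Thm. 17.20 [LeeSmoothManifolds2013].
-/

noncomputable section

-- the registered namespace `Summit.SmoothPoincare4.SmoothPoincare4.Theorems` repeats a component
set_option linter.dupNamespace false

open scoped Manifold ContDiff Topology
open Set Filter Metric
open Literature.Geometry.Kaehler

namespace Summit.SmoothPoincare4.SmoothPoincare4.Theorems

namespace SullivanDual

/-! ### Chart-set bookkeeping -/

section ChartSets

variable {E : Type*} [NormedAddCommGroup E] [NormedSpace ℝ E]
  {H : Type*} [TopologicalSpace H] {I : ModelWithCorners ℝ E H}
  {M : Type*} [TopologicalSpace M] [ChartedSpace H M]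
  {F : Type*} [NormedAddCommGroup F] [NormedSpace ℝ F] {k : ℕ}

/-- Transport of "closed forms are exact" along an equality of open sets. [folklore] -/
theorem localClosedForms_le_localExactForms_congr_set [IsManifold I ∞ M] {U V : Set M} (h : U = V)
    (hU : IsOpen U) (hV : IsOpen V) (hle : localClosedForms I F k U ≤ localExactForms I F hU k) :
    localClosedForms I F k V ≤ localExactForms I F hV k := by
  subst h
  exact hle

/-- Chart sets commute with binary unions. [folklore] -/
theorem chartSet_union' (p : M) (C₁ C₂ : Set E) :
    chartSet I p (C₁ ∪ C₂) = chartSet I p C₁ ∪ chartSet I p C₂ := by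
  ext x
  simp only [mem_union, mem_chartSet_iff]
  tauto

/-- The chart set of `C ⊆ e.target` is the image of `C` under the inverse chart. [folklore] -/
theorem chartSet_eq_image_symm (p : M) {C : Set E} (hCT : C ⊆ (extChartAt I p).target) :
    chartSet I p C = (extChartAt I p).symm '' C := by
  ext x
  constructor
  · intro hx
    exact ⟨extChartAt I p x, hx.2, (extChartAt I p).left_inv hx.1⟩
  · rintro ⟨y, hy, rfl⟩
    exact symm_mem_chartSet hCT hy

/-- Chart sets of preconnected subsets of the chart target are preconnected. [folklore] -/
theorem isPreconnected_chartSet (p : M) {C : Set E} (hCT : C ⊆ (extChartAt I p).target)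
    (hC : IsPreconnected C) : IsPreconnected (chartSet I p C) := by
  rw [chartSet_eq_image_symm p hCT]
  exact hC.image _ ((continuousOn_extChartAt_symm p).mono hCT)

end ChartSets

/-! ### Flat pieces of the punctured `4`-ball -/

section Flat

/-- A recentred coordinate `y ↦ (y - c) i` is continuous on `ℝ⁴`. [folklore] -/
theorem continuous_coord_sub (c : EuclideanSpace ℝ (Fin 4)) (i : Fin 4) :
    Continuous fun y : EuclideanSpace ℝ (Fin 4) => (y - c) i :=
  (PiLp.continuous_apply 2 (fun _ : Fin 4 => ℝ) i).comp (continuous_id.sub continuous_const)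

/-- The piece "ball minus a closed half of the `x₃`-axis" is open. [folklore] -/
theorem isOpen_ball_diff_halfAxis (c : EuclideanSpace ℝ (Fin 4)) (r σ : ℝ) :
    IsOpen {y : EuclideanSpace ℝ (Fin 4) | y ∈ Metric.ball c r ∧
      (0 < σ * (y - c) 3 ∨ (y - c) 0 ≠ 0 ∨ (y - c) 1 ≠ 0 ∨ (y - c) 2 ≠ 0)} := by
  simp only [setOf_and, setOf_or, setOf_mem_eq]
  exact isOpen_ball.inter ((isOpen_lt continuous_const
    (continuous_const.mul (continuous_coord_sub c 3))).union
    ((isOpen_ne_fun (continuous_coord_sub c 0) continuous_const).union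
    ((isOpen_ne_fun (continuous_coord_sub c 1) continuous_const).union
    (isOpen_ne_fun (continuous_coord_sub c 2) continuous_const))))

/-- The piece "ball minus a closed half-plane" is open. [folklore] -/
theorem isOpen_ball_diff_halfPlane (c : EuclideanSpace ℝ (Fin 4)) (r σ : ℝ) :
    IsOpen {y : EuclideanSpace ℝ (Fin 4) | y ∈ Metric.ball c r ∧
      (0 < σ * (y - c) 2 ∨ (y - c) 0 ≠ 0 ∨ (y - c) 1 ≠ 0)} := by
  simp only [setOf_and, setOf_or, setOf_mem_eq]
  exact isOpen_ball.inter ((isOpen_lt continuous_const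
    (continuous_const.mul (continuous_coord_sub c 2))).union
    ((isOpen_ne_fun (continuous_coord_sub c 0) continuous_const).union
    (isOpen_ne_fun (continuous_coord_sub c 1) continuous_const)))

/-- The two half-axis pieces cover the punctured ball. [folklore] -/
theorem ball_diff_halfAxis_union (c : EuclideanSpace ℝ (Fin 4)) (r : ℝ) :
    {y : EuclideanSpace ℝ (Fin 4) | y ∈ Metric.ball c r ∧
        (0 < 1 * (y - c) 3 ∨ (y - c) 0 ≠ 0 ∨ (y - c) 1 ≠ 0 ∨ (y - c) 2 ≠ 0)} ∪
      {y : EuclideanSpace ℝ (Fin 4) | y ∈ Metric.ball c r ∧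
        (0 < -1 * (y - c) 3 ∨ (y - c) 0 ≠ 0 ∨ (y - c) 1 ≠ 0 ∨ (y - c) 2 ≠ 0)} =
      Metric.ball c r \ {c} := by
  ext y
  simp only [mem_union, mem_setOf_eq, Set.mem_sdiff, mem_singleton_iff, one_mul, neg_one_mul,
    Left.neg_pos_iff]
  constructor
  · rintro (⟨hB, h⟩ | ⟨hB, h⟩) <;> refine ⟨hB, ?_⟩ <;> rintro rfl <;> simp at h
  · rintro ⟨hB, hne⟩
    by_cases h0 : (y - c) 0 = 0
    · by_cases h1 : (y - c) 1 = 0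
      · by_cases h2 : (y - c) 2 = 0
        · rcases lt_trichotomy ((y - c) 3) 0 with h3 | h3 | h3
          · exact Or.inr ⟨hB, Or.inl h3⟩
          · exfalso
            apply hne
            rw [← sub_eq_zero]
            ext i
            fin_cases i
            · simpa using h0
            · simpa using h1
            · simpa using h2
            · simpa using h3
          · exact Or.inl ⟨hB, Or.inl h3⟩
        · exact Or.inl ⟨hB, Or.inr (Or.inr (Or.inr h2))⟩
      · exact Or.inl ⟨hB, Or.inr (Or.inr (Or.inl h1))⟩
    · exact Or.inl ⟨hB, Or.inr (Or.inl h0)⟩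

/-- The two half-axis pieces meet in "ball minus the axis". [folklore] -/
theorem ball_diff_halfAxis_inter (c : EuclideanSpace ℝ (Fin 4)) (r : ℝ) :
    {y : EuclideanSpace ℝ (Fin 4) | y ∈ Metric.ball c r ∧
        (0 < 1 * (y - c) 3 ∨ (y - c) 0 ≠ 0 ∨ (y - c) 1 ≠ 0 ∨ (y - c) 2 ≠ 0)} ∩
      {y : EuclideanSpace ℝ (Fin 4) | y ∈ Metric.ball c r ∧
        (0 < -1 * (y - c) 3 ∨ (y - c) 0 ≠ 0 ∨ (y - c) 1 ≠ 0 ∨ (y - c) 2 ≠ 0)} =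
      {y : EuclideanSpace ℝ (Fin 4) | y ∈ Metric.ball c r ∧
        ((y - c) 0 ≠ 0 ∨ (y - c) 1 ≠ 0 ∨ (y - c) 2 ≠ 0)} := by
  ext y
  simp only [mem_inter_iff, mem_setOf_eq, one_mul, neg_one_mul, Left.neg_pos_iff]
  constructor
  · rintro ⟨⟨hB, h | h⟩, -, h' | h'⟩
    · exact absurd (h.trans h') (lt_irrefl _)
    · exact ⟨hB, h'⟩
    · exact ⟨hB, h⟩
    · exact ⟨hB, h⟩
  · rintro ⟨hB, h⟩
    exact ⟨⟨hB, Or.inr h⟩, hB, Or.inr h⟩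

/-- The two half-plane pieces cover "ball minus the axis". [folklore] -/
theorem ball_diff_halfPlane_union (c : EuclideanSpace ℝ (Fin 4)) (r : ℝ) :
    {y : EuclideanSpace ℝ (Fin 4) | y ∈ Metric.ball c r ∧
        (0 < 1 * (y - c) 2 ∨ (y - c) 0 ≠ 0 ∨ (y - c) 1 ≠ 0)} ∪
      {y : EuclideanSpace ℝ (Fin 4) | y ∈ Metric.ball c r ∧
        (0 < -1 * (y - c) 2 ∨ (y - c) 0 ≠ 0 ∨ (y - c) 1 ≠ 0)} =
      {y : EuclideanSpace ℝ (Fin 4) | y ∈ Metric.ball c r ∧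
        ((y - c) 0 ≠ 0 ∨ (y - c) 1 ≠ 0 ∨ (y - c) 2 ≠ 0)} := by
  ext y
  simp only [mem_union, mem_setOf_eq, one_mul, neg_one_mul, Left.neg_pos_iff]
  constructor
  · rintro (⟨hB, h | h⟩ | ⟨hB, h | h⟩)
    · exact ⟨hB, Or.inr (Or.inr h.ne')⟩
    · exact ⟨hB, by tauto⟩
    · exact ⟨hB, Or.inr (Or.inr h.ne)⟩
    · exact ⟨hB, by tauto⟩
  · rintro ⟨hB, h | h | h⟩
    · exact Or.inl ⟨hB, Or.inr (Or.inl h)⟩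
    · exact Or.inl ⟨hB, Or.inr (Or.inr h)⟩
    · rcases lt_or_gt_of_ne h with h2 | h2
      · exact Or.inr ⟨hB, Or.inl h2⟩
      · exact Or.inl ⟨hB, Or.inl h2⟩

/-- The two half-plane pieces meet in "ball minus the plane". [folklore] -/
theorem ball_diff_halfPlane_inter (c : EuclideanSpace ℝ (Fin 4)) (r : ℝ) :
    {y : EuclideanSpace ℝ (Fin 4) | y ∈ Metric.ball c r ∧
        (0 < 1 * (y - c) 2 ∨ (y - c) 0 ≠ 0 ∨ (y - c) 1 ≠ 0)} ∩
      {y : EuclideanSpace ℝ (Fin 4) | y ∈ Metric.ball c r ∧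
        (0 < -1 * (y - c) 2 ∨ (y - c) 0 ≠ 0 ∨ (y - c) 1 ≠ 0)} =
      {y : EuclideanSpace ℝ (Fin 4) | y ∈ Metric.ball c r ∧
        ((y - c) 0 ≠ 0 ∨ (y - c) 1 ≠ 0)} := by
  ext y
  simp only [mem_inter_iff, mem_setOf_eq, one_mul, neg_one_mul, Left.neg_pos_iff]
  constructor
  · rintro ⟨⟨hB, h | h⟩, -, h' | h'⟩
    · exact absurd (h.trans h') (lt_irrefl _)
    · exact ⟨hB, h'⟩
    · exact ⟨hB, h⟩
    · exact ⟨hB, h⟩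
  · rintro ⟨hB, h⟩
    exact ⟨⟨hB, Or.inr h⟩, hB, Or.inr h⟩

end Flat

/-! ### The Poincaré lemma in degree two for the punctured chart ball -/

/-- **`H²_dR` of a punctured chart `4`-ball vanishes.** For `e = extChartAt (𝓡 4) p` and a radius
`r > 0` with `ball (e p) r ⊆ e.target`, every smooth closed `2`-form on the punctured chart-ball
`W = chartSet (𝓡 4) p (ball (e p) r ∖ {e p})` (a form on `M` smooth at the points of `W`, zero off
`W`, with `dα = 0` on `W`) is `d_W β` for a smooth `1`-form `β` on `W`. Mayer–Vietoris twice: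
`W = P ∪ Q` with `P`, `Q` the chart sets of "ball minus a closed half-axis" (star-shaped, hence
acyclic), `P ∩ Q` the chart set of "ball minus the axis", whose `H¹` vanishes because it is in turn
the union of the chart sets of "ball minus a closed half-plane" (star-shaped) meeting in the
connected "ball minus a plane". [cite: BottTu1982Forms, Prop. 2.3] -/
theorem helper_poincareLemma_two_puncturedChartBall
    {M : Type} [TopologicalSpace M] [T2Space M] [SecondCountableTopology M]
    [ChartedSpace (EuclideanSpace ℝ (Fin 4)) M] [IsManifold (𝓡 4) ∞ M]
    (p : M) {r : ℝ} (hr : 0 < r)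
    (hball : Metric.ball (extChartAt (𝓡 4) p p) r ⊆ (extChartAt (𝓡 4) p).target)
    (hW : IsOpen (chartSet (𝓡 4) p
      (Metric.ball (extChartAt (𝓡 4) p p) r \ {extChartAt (𝓡 4) p p}))) :
    localClosedForms (𝓡 4) ℝ 2
        (chartSet (𝓡 4) p (Metric.ball (extChartAt (𝓡 4) p p) r \ {extChartAt (𝓡 4) p p})) ≤
      localExactForms (𝓡 4) ℝ hW 2 := by
  set c : EuclideanSpace ℝ (Fin 4) := extChartAt (𝓡 4) p p with hc
  -- the four flat pieces `A₁ A₂` (ball minus a closed half-axis) and `B₁ B₂` (ball minus a closed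
  -- half-plane) are open, lie in the chart target and are star-shaped (landed flat geometry)
  have hA₁o := isOpen_ball_diff_halfAxis c r 1
  have hA₂o := isOpen_ball_diff_halfAxis c r (-1)
  have hB₁o := isOpen_ball_diff_halfPlane c r 1
  have hB₂o := isOpen_ball_diff_halfPlane c r (-1)
  have hA₁s := helper_starConvex_ball_diff_halfAxis c hr (Or.inl rfl : (1 : ℝ) = 1 ∨ (1 : ℝ) = -1)
  have hA₂s :=
    helper_starConvex_ball_diff_halfAxis c hr (Or.inr rfl : (-1 : ℝ) = 1 ∨ (-1 : ℝ) = -1)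
  have hB₁s := helper_starConvex_ball_diff_halfPlane c hr (Or.inl rfl : (1 : ℝ) = 1 ∨ (1 : ℝ) = -1)
  have hB₂s :=
    helper_starConvex_ball_diff_halfPlane c hr (Or.inr rfl : (-1 : ℝ) = 1 ∨ (-1 : ℝ) = -1)
  -- their chart sets `P₁ Q₁ P₂ Q₂`
  have hP₁ := isOpen_chartSet (𝓡 4) p hA₁o
  have hQ₁ := isOpen_chartSet (𝓡 4) p hA₂o
  have hP₂ := isOpen_chartSet (𝓡 4) p hB₁o
  have hQ₂ := isOpen_chartSet (𝓡 4) p hB₂o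
  -- Poincaré lemma on the four star-shaped chart sets
  have hP₁e : localClosedForms (𝓡 4) ℝ 2 _ ≤ localExactForms (𝓡 4) ℝ hP₁ 2 :=
    localClosedForms_chartSet_le_localExactForms_of_starConvex p hA₁o hA₁s fun y hy => hball hy.1
  have hQ₁e : localClosedForms (𝓡 4) ℝ 2 _ ≤ localExactForms (𝓡 4) ℝ hQ₁ 2 :=
    localClosedForms_chartSet_le_localExactForms_of_starConvex p hA₂o hA₂s fun y hy => hball hy.1
  have hP₂e : localClosedForms (𝓡 4) ℝ 1 _ ≤ localExactForms (𝓡 4) ℝ hP₂ 1 :=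
    localClosedForms_chartSet_le_localExactForms_of_starConvex p hB₁o hB₁s fun y hy => hball hy.1
  have hQ₂e : localClosedForms (𝓡 4) ℝ 1 _ ≤ localExactForms (𝓡 4) ℝ hQ₂ 1 :=
    localClosedForms_chartSet_le_localExactForms_of_starConvex p hB₂o hB₂s fun y hy => hball hy.1
  -- step 1: `H¹` of "ball minus the axis" vanishes: its two half-plane pieces meet in the chart
  -- set of "ball minus the plane", which is connected
  have hZ : IsPreconnected
      (chartSet (𝓡 4) p {y : EuclideanSpace ℝ (Fin 4) | y ∈ Metric.ball c r ∧
          (0 < 1 * (y - c) 2 ∨ (y - c) 0 ≠ 0 ∨ (y - c) 1 ≠ 0)} ∩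
        chartSet (𝓡 4) p {y : EuclideanSpace ℝ (Fin 4) | y ∈ Metric.ball c r ∧
          (0 < -1 * (y - c) 2 ∨ (y - c) 0 ≠ 0 ∨ (y - c) 1 ≠ 0)}) := by
    rw [chartSet_inter, ball_diff_halfPlane_inter c r]
    exact isPreconnected_chartSet p (fun y hy => hball hy.1)
      (helper_isPreconnected_ball_diff_plane c hr)
  have hY := helper_localClosedForms_one_union_le_of_isPreconnected hP₂ hQ₂ hP₂e hQ₂e hZ
  -- transport step 1 to `P₁ ∩ Q₁` (both are the chart set of "ball minus the axis")
  have hYeq : chartSet (𝓡 4) p {y : EuclideanSpace ℝ (Fin 4) | y ∈ Metric.ball c r ∧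
          (0 < 1 * (y - c) 2 ∨ (y - c) 0 ≠ 0 ∨ (y - c) 1 ≠ 0)} ∪
        chartSet (𝓡 4) p {y : EuclideanSpace ℝ (Fin 4) | y ∈ Metric.ball c r ∧
          (0 < -1 * (y - c) 2 ∨ (y - c) 0 ≠ 0 ∨ (y - c) 1 ≠ 0)} =
      chartSet (𝓡 4) p {y : EuclideanSpace ℝ (Fin 4) | y ∈ Metric.ball c r ∧
          (0 < 1 * (y - c) 3 ∨ (y - c) 0 ≠ 0 ∨ (y - c) 1 ≠ 0 ∨ (y - c) 2 ≠ 0)} ∩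
        chartSet (𝓡 4) p {y : EuclideanSpace ℝ (Fin 4) | y ∈ Metric.ball c r ∧
          (0 < -1 * (y - c) 3 ∨ (y - c) 0 ≠ 0 ∨ (y - c) 1 ≠ 0 ∨ (y - c) 2 ≠ 0)} := by
    rw [← chartSet_union', chartSet_inter, ball_diff_halfPlane_union c r,
      ball_diff_halfAxis_inter c r]
  have hPQ₁ : localClosedForms (𝓡 4) ℝ 1 _ ≤ localExactForms (𝓡 4) ℝ (hP₁.inter hQ₁) 1 :=
    localClosedForms_le_localExactForms_congr_set hYeq _ _ hY
  -- step 2: `H²` of the punctured ball from its two half-axis pieces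
  have hX := helper_localClosedForms_succ_union_le_of_inter hP₁ hQ₁ 1 hP₁e hQ₁e hPQ₁
  have hXeq : chartSet (𝓡 4) p {y : EuclideanSpace ℝ (Fin 4) | y ∈ Metric.ball c r ∧
          (0 < 1 * (y - c) 3 ∨ (y - c) 0 ≠ 0 ∨ (y - c) 1 ≠ 0 ∨ (y - c) 2 ≠ 0)} ∪
        chartSet (𝓡 4) p {y : EuclideanSpace ℝ (Fin 4) | y ∈ Metric.ball c r ∧
          (0 < -1 * (y - c) 3 ∨ (y - c) 0 ≠ 0 ∨ (y - c) 1 ≠ 0 ∨ (y - c) 2 ≠ 0)} =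
      chartSet (𝓡 4) p (Metric.ball c r \ {c}) := by
    rw [← chartSet_union', ball_diff_halfAxis_union c r]
  exact localClosedForms_le_localExactForms_congr_set hXeq _ _ hX

end SullivanDual

end Summit.SmoothPoincare4.SmoothPoincare4.Theorems

end
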